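import Summits.PneNP.PneNP.Theorems.SymmetryBudgetNoHiddenOrderLexMinSocketDefs

/-!
# `NoHiddenOrder` (stmt-PneNP-14781): the lex-min socket — what a symmetric threshold PROGRAM
# must provide to close the crux

Route `PneNP/SymmetryBudget`; definitions in `SymmetryBudgetNoHiddenOrderLexMinSocketDefs.lean`.
The positive landing pad `noHiddenOrder_of_entrywiseCanoniser`
(`SymmetryBudgetNoHiddenOrderOfGraphCanonisation.lean`) asks for `Bud(m,⌊log₂ m⌋)`-symmetric
threshold circuits, one per output entry, computing a matrix whose graph is the graph of a
`Bud`-relabelling of the input.  Every construction on file (certified labels over the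
Corneil–Goldberg tree, PROOF-NoHiddenOrder / PER-PATH memos on the item) has the same top layer:
gate groups indexed by LABELS, each producing a flag ("my label decodes and my run succeeds") and a
candidate relabelled matrix, and the output is the lexicographically least flagged candidate.
With the symmetric-threshold-PROGRAM calculus (`Literature/…/SymmetricThresholdPrograms*.lean`)
that top layer and the whole circuit-level bookkeeping are discharged here once and for all:

* `LexMinProgram.hasSymCircuit_CF` — every entry of the computed matrix is a `Bud`-symmetric
  `tcBasis` circuit with `2·|Λ|+2` gates (`SymProg.hasSymCircuit_gate`);
* `LexMinProgram.exists_CF_eq` — the computed matrix is `x ∘ (ρ × ρ)` for some `ρ` in the budget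
  (`SymProg.LexMin.exists_sem_out_eq` + soundness);
* `noHiddenOrder_of_lexMinProgram` — hence `NoHiddenOrder` from a lex-min program of polynomial
  size for all large `m`;
* `noHiddenOrder_of_lexMinReadoutProgram` — the same with soundness discharged by the readout
  gadget: it only remains that a flagged label's position wires encode a permutation fixing the
  ordered part (`SymProg.Readout.Encodes`), plus completeness (some flag on every input).
Sorry-free; supports stmt-PneNP-14781, does not close it.
-/

set_option linter.dupNamespace false -- `Summit.PneNP.PneNP.…` (D-0017 single-conjunct layout)

namespace Summit.PneNP.PneNP.Theorems

open scoped Classical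
open Filter Literature.Computability.Complexity Literature.Computability.Complexity.SymProg
open Summit.PneNP.PneNP.Theses.SymmetryBudget

namespace LexMinProgram

variable {m : ℕ} (D : LexMinProgram m)

/-- **Every entry of the computed matrix is a `Bud`-symmetric threshold circuit of size
`2·|Λ| + 2`.** [cite: AndersonDawar2016, §3 (FPC to symmetric circuits)] -/
theorem hasSymCircuit_CF (q₀ : Fin m × Fin m) :
    HasSymCircuit tcBasis (pointStabiliserBudget m (Nat.log 2 m)) (2 * Fintype.card D.Λ + 2)
      fun x => D.CF x q₀ :=
  D.P.hasSymCircuit_gate _ D.θ D.isSym fun ρ hρ => D.out_fixed ρ hρ _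

/-- **The computed matrix is a `Bud`-relabelling of the input** (lex-min of the flagged candidates).
[folklore] -/
theorem exists_CF_eq (x : Fin m × Fin m → Bool) :
    ∃ ρ ∈ pointStabiliserBudget m (Nat.log 2 m), ∀ q₀, D.CF x q₀ = x (ρ q₀.1, ρ q₀.2) := by
  obtain ⟨ℓ, hbest, hout⟩ := D.G.exists_sem_out_eq x (D.complete x)
  obtain ⟨ρ, hρ, hval⟩ := D.sound x ℓ hbest.1
  exact ⟨ρ, hρ, fun q₀ => (hout _).trans (hval q₀)⟩

end LexMinProgram

/-- **The lex-min socket.** If for one polynomial `q` and all large `m` there is a lex-min program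
of size `2·|Λ| + 2 ≤ q m` (symmetric threshold program with a lex-min gadget on top, symmetry data
for the budget fixing the outputs, sound flagged labels, and always some flagged label), then
`NoHiddenOrder` — via the entry-wise landing pad `noHiddenOrder_of_entrywiseCanoniser`. [folklore] -/
theorem noHiddenOrder_of_lexMinProgram (q : Polynomial ℕ)
    (h : ∀ᶠ m : ℕ in atTop, ∃ D : LexMinProgram m, 2 * Fintype.card D.Λ + 2 ≤ q.eval m) :
    NoHiddenOrder := by
  refine noHiddenOrder_of_entrywiseCanoniser q (h.mono fun m hm => ?_)
  obtain ⟨D, hsize⟩ := hm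
  refine ⟨D.CF, fun q₀ => ?_, fun x => ?_⟩
  · obtain ⟨C, hB, hs, hS, hc⟩ := D.hasSymCircuit_CF q₀
    exact ⟨C, hB, hs.trans hsize, hS, hc⟩
  · obtain ⟨ρ, hρ, hCF⟩ := D.exists_CF_eq x
    refine ⟨ρ, hρ, ?_⟩
    have : D.CF x = fun q₀ => x (ρ q₀.1, ρ q₀.2) := funext hCF
    rw [this]

namespace LexMinReadoutProgram

variable {m : ℕ} (D : LexMinReadoutProgram m)

/-- The size is unchanged. [folklore] -/
theorem card_toLexMinProgram : Fintype.card D.toLexMinProgram.Λ = Fintype.card D.Λ := rfl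

end LexMinReadoutProgram

/-- **The lex-min/readout socket.** If for one polynomial `q` and all large `m` there is a
lex-min readout program of size `2·|Λ| + 2 ≤ q m`, then `NoHiddenOrder`. What such a program asks
of a window-canonisation construction: gates and symmetry data (bookkeeping), flags whose position
wires encode a `Bud`-permutation when raised (soundness of ONE label's run — "certification"), and
a flag raised on every input (completeness — the per-path entropy mathematics). [folklore] -/
theorem noHiddenOrder_of_lexMinReadoutProgram (q : Polynomial ℕ)
    (h : ∀ᶠ m : ℕ in atTop, ∃ D : LexMinReadoutProgram m, 2 * Fintype.card D.Λ + 2 ≤ q.eval m) :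
    NoHiddenOrder :=
  noHiddenOrder_of_lexMinProgram q (h.mono fun _ ⟨D, hD⟩ => ⟨D.toLexMinProgram, hD⟩)

end Summit.PneNP.PneNP.Theorems
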